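import Literature.NumberTheory.GaloisRepresentations.CyclicLayerFrobeniusClassInflation
import Literature.NumberTheory.GaloisRepresentations.LocalUnramifiedLayerClassModule
import Literature.NumberTheory.GaloisRepresentations.LocalFieldInertiaCdOne
import Literature.NumberTheory.GaloisCohomology.LocalInvariantOfUnramifiedClass
import HarnessLib

/-!
# The Brauer invariant of the engine's unramified fundamental class: `inv_K (inf [c_σ · π_K]) = −1/m`
# (Serre, *Local Fields* XIII §3, XIV §1 Prop. 3; Neukirch, *Bonn Lectures* II §4 Def. (4.5))

Topic `NumberTheory/GaloisRepresentations` (local class field theory); namespace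
`Literature.NumberTheory.GaloisRepresentations.UnitsLayer`.  Proof file: theorems only (no definition,
no named fact, no instance, no notation; D-0026).

The NORMALISATION AGREEMENT between the finite-group class-module engine and the tree's canonical local
invariant.  For a non-archimedean local field `K : Type` of characteristic `0`, its unramified level
`K_m = unramifiedLevel K m ⊆ K̄`, the ARITHMETIC Frobenius `σ = φ|_{K_m}` (`φ ∈ Γ_K` with `IsFrobPow φ 1`)
and a uniformiser `π_K`:

* `layerCyclicCharacter_apply_eq_zero_of_mem_absInertia` — the character `θ_σ : Γ_K ↠ ℤ/|Gal(K_m/K)|`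
  of `CyclicLayerFrobeniusClassInflation` is unramified (inertia `≤ Gal(K̄/K_m) = ker θ_σ`);
* **`brauerInvariantEquiv_unitsInfTwo_frobeniusCocycle`**: the image under
  `unitsInfTwo : H²(Gal(K_m/K), K_mˣ) ↪ H²(K, K̄ˣ)` of the engine's Frobenius class `[c_σ · π_K]` — the
  fundamental class `u` of the unramified class module `(K_mˣ)` with `inv_σ(u) = +1/[K_m:K]` in the ENGINE's
  normalisation (door-c6 g9 `exists_isClassModule_invariantMap_eq_unramifiedLevel`) — has Brauer invariant
  `Prop121vii.brauerInvariantEquiv K (…) = −(1 % |Gal(K_m/K)|)/|Gal(K_m/K)| = −1/m ∈ ℚ/ℤ` in the TREE's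
  normalisation (`brauerInvariantEquiv`, `= inv_n/n` on Kummer images; the sign is the tree's
  `Kummer(κ_n(x) ∪ θ) = −(θ, x)`), by `unitsInfTwo_H2π_frobeniusCocycle` + the tree's
  `brauerInvariantEquiv_cyclicClass_of_unramified` (`inv_K (θ, x) = −v(x)·θ(φ)/n`).

So a Poitou–Tate assembly that moves fundamental classes of the engine into `galoisCohomology` through
`unitsInfTwo` must use `−[c_σ · π_K]` (equivalently the generator `σ⁻¹`) to match THE invariant maps
`LocalInvariants.canonical` of the tree.  Written for the bsd-schneider cell (crux `AnticycControlAdditiveK`).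

## References
* J.-P. Serre, *Local Fields*, GTM 67 (1979), Ch. XIII §3 (`inv_K` of the unramified classes), Ch. XIV §1
  Prop. 3. [SerreLocalFields1979]
* J. Neukirch, *Class Field Theory — The Bonn Lectures* (2013), Part II §4 Def. (4.5). [Neukirch2013]
-/

noncomputable section

open CategoryTheory groupCohomology Field

namespace Literature.NumberTheory.GaloisRepresentations

namespace UnitsLayer

open LocalWeilDatum DiscreteGaloisModule Literature.Algebra.Homology IsNonarchimedeanLocalField
open Literature.AnabelianGeometry.AbsoluteAnabelian Literature.AnabelianGeometry.AbsoluteAnabelian.Prop121vii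
open Literature.NumberTheory.GaloisCohomology ValuativeRel
open scoped Valued

attribute [local instance] absoluteGaloisGroup_compactSpace

variable (K : Type) [Field K] [ValuativeRel K] [TopologicalSpace K] [IsNonarchimedeanLocalField K]
  [CharZero K]

omit [CharZero K] in
/-- **`θ_σ` is unramified**: the cyclic character of the unramified level attached to a generator `σ` of
`Gal(K_m/K)` kills the inertia group (`I_K ≤ Gal(K̄/K_m) = ker θ_σ`).
[cite: SerreLocalFields1979, Ch. XIII §3] -/
theorem layerCyclicCharacter_apply_eq_zero_of_mem_absInertia {m : ℕ} (hm : 0 < m)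
    [IsGalois K (unramifiedLevel K m)]
    (σ : unramifiedLevel K m ≃ₐ[K] unramifiedLevel K m) (hσ : ∀ x, x ∈ Subgroup.zpowers σ)
    (τ : absoluteGaloisGroup K) (hτ : τ ∈ absInertia K) :
    haveI := finiteDimensional_unramifiedLevel K hm
    layerCyclicCharacter K (unramifiedLevel K m) σ hσ τ = 0 := by
  haveI := finiteDimensional_unramifiedLevel K hm
  have hker : τ ∈ absGaloisFixingSubgroup (unramifiedLevel K m) := by
    rw [← galFixing_eq_absGaloisFixingSubgroup]
    exact galUnr_le_galFixing_unramifiedLevel K hm ((galUnr_eq_absInertia K).symm ▸ hτ)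
  rw [← CyclicCharacter.mem_ker, ker_layerCyclicCharacter]
  exact hker

omit [CharZero K] in
/-- **The arithmetic Frobenius generates `Gal(K_m/K)`**: there is `φ ∈ Γ_K` with `IsFrobPow φ 1` whose
restriction `φ|_{K_m}` generates (Weil density: a homomorphism of `Γ_K` with open kernel containing the
inertia has image generated by the image of Frobenius, tree `range_eq_zpowers_of_absInertia_le_ker`) —
so the hypotheses `hσ`, `hσφ` below are satisfiable with `σ := φ|_{K_m}`.
[cite: SerreLocalFields1979, Ch. XIII §4 Prop. 13][cite: NeukirchANT1999, Ch. IV §4] -/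
theorem exists_isFrobPow_forall_mem_zpowers_resGal {m : ℕ} (hm : 0 < m)
    [IsGalois K (unramifiedLevel K m)] :
    ∃ φ : absoluteGaloisGroup K, IsFrobPow φ 1 ∧
      ∀ x, x ∈ Subgroup.zpowers (resGal (unramifiedLevel K m) φ) := by
  haveI := finiteDimensional_unramifiedLevel K hm
  obtain ⟨φ, hφ⟩ := exists_isAbsArithFrob_holds K
  refine ⟨φ, IsAbsArithFrob.isFrobPow_holds hφ, fun x => ?_⟩
  have hopen : IsOpen (((resGal (unramifiedLevel K m)).ker : Subgroup (absoluteGaloisGroup K)) :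
      Set (absoluteGaloisGroup K)) := by
    rw [← absGaloisFixingSubgroup_eq_ker_resGal]
    exact isOpen_absGaloisFixingSubgroup K _
  have hI : absInertia K ≤ (resGal (unramifiedLevel K m)).ker := by
    intro τ hτ
    rw [← absGaloisFixingSubgroup_eq_ker_resGal, ← galFixing_eq_absGaloisFixingSubgroup]
    exact galUnr_le_galFixing_unramifiedLevel K hm ((galUnr_eq_absInertia K).symm ▸ hτ)
  have h := IsNonarchimedeanLocalField.range_eq_zpowers_of_absInertia_le_ker
    (resGal (unramifiedLevel K m)) hopen hI hφ
  have hx : x ∈ (resGal (unramifiedLevel K m)).range := by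
    rw [MonoidHom.range_eq_top.2 (resGal_surjective _)]
    exact Subgroup.mem_top x
  rw [h] at hx
  exact hx

/-- **The Brauer invariant of the engine's unramified fundamental class is `−1/m`**: for the arithmetic
Frobenius `σ = φ|_{K_m}` generating `Gal(K_m/K)` and a uniformiser `π_K`,
`inv_K (unitsInfTwo [c_σ · π_K]) = −(1 % |Gal(K_m/K)|)/|Gal(K_m/K)| ∈ ℚ/ℤ` (`= −1/m` for `m > 1`; both
sides `0` for `m = 1`).  The engine's own invariant of this class is `+1/m`
(`exists_isClassModule_invariantMap_eq_unramifiedLevel`); the sign is the tree's convention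
`Kummer(κ_n(x) ∪ θ) = −(θ, x)` for `cyclicClass`.
[cite: SerreLocalFields1979, Ch. XIII §3, Ch. XIV §1 Prop. 3][cite: Neukirch2013, Part II §4 Def. (4.5)] -/
theorem brauerInvariantEquiv_unitsInfTwo_frobeniusCocycle {m : ℕ} (hm : 0 < m)
    [IsGalois K (unramifiedLevel K m)]
    (σ : unramifiedLevel K m ≃ₐ[K] unramifiedLevel K m) (hσ : ∀ x, x ∈ Subgroup.zpowers σ)
    {φ : absoluteGaloisGroup K} (hφ : IsFrobPow φ 1) (hσφ : resGal (unramifiedLevel K m) φ = σ)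
    (π : 𝒪[K]) (hπ : Irreducible π)
    (hϖ : ∀ g : unramifiedLevel K m ≃ₐ[K] unramifiedLevel K m,
      (Rep.ofAlgebraAutOnUnits K (unramifiedLevel K m)).ρ g
        (Additive.ofMul (Units.mk0 (algebraMap K (unramifiedLevel K m) (π : K))
          ((map_ne_zero _).2 fun h => hπ.ne_zero (Subtype.ext h)))) =
        Additive.ofMul (Units.mk0 (algebraMap K (unramifiedLevel K m) (π : K))
          ((map_ne_zero _).2 fun h => hπ.ne_zero (Subtype.ext h)))) :
    haveI := finiteDimensional_unramifiedLevel K hm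
    brauerInvariantEquiv K (unitsInfTwo K (unramifiedLevel K m)
      (H2π _ (Unramified.frobeniusCocycle σ hσ (Rep.ofAlgebraAutOnUnits K (unramifiedLevel K m)) _ hϖ))) =
      -((((1 % Fintype.card (unramifiedLevel K m ≃ₐ[K] unramifiedLevel K m) : ℕ) : ℚ) /
          (Fintype.card (unramifiedLevel K m ≃ₐ[K] unramifiedLevel K m) : ℕ) : ℚ) : AddCircle (1 : ℚ)) := by
  haveI := finiteDimensional_unramifiedLevel K hm
  have hπ0 : (π : K) ≠ 0 := fun h => hπ.ne_zero (Subtype.ext h)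
  rw [unitsInfTwo_H2π_frobeniusCocycle]
  -- the base unit is the tree's `baseUnitsInvariant K π`
  have hbase : baseUnitInvariant K (unramifiedLevel K m) _ hϖ = baseUnitsInvariant K (π : K) hπ0 :=
    Subtype.ext (congrArg UnitsCarrier.ofUnits (Units.ext rfl))
  rw [hbase, brauerInvariantEquiv_cyclicClass_of_unramified K
    (layerCyclicCharacter K (unramifiedLevel K m) σ hσ)
    (layerCyclicCharacter_apply_eq_zero_of_mem_absInertia K hm σ hσ) hφ (π : K) hπ0,
    ord_eq_one_of_irreducible K hπ, val_layerCyclicCharacter, hσφ, Unramified.exponent_self, one_mul,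
    Int.cast_natCast]

end UnitsLayer

end Literature.NumberTheory.GaloisRepresentations

end
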